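import Literature.NumberTheory.QuadraticFields.RealQuadraticFundamentalUnitValues
import Mathlib.Analysis.Real.Sqrt
import HarnessLib

/-!
# The fundamental unit of a real quadratic discriminant by a PRINCIPAL-CYCLE CERTIFICATE, and the values at
# `D = 225077, 214037, 24653, 74093, 170957`

Topic `NumberTheory/QuadraticFields`, namespace `Literature.NumberTheory.QuadraticFields` (sub-namespace `QuadIrr` for the
certificate and the units, `Quadratic` for the field-side regulators); continues `RealQuadraticPrincipalCycle.lean`
(`QuadIrr.fundUnit D = ∏_{k=1}^{p} ψ_k` over the principal cycle of `δ = (q + √D)/2`, `q = D mod 2`;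
`exists_fundUnit_eq`: `ε = (G + B√D)/2` with `(A, B) = (A_{p−1}, B_{p−1})` the `(p−1)`-st convergent of `δ` and
`G = 2A − qB`), `RealQuadraticFundamentalUnit.lean` (minimality) and the finite-check files
`RealQuadraticFundamentalUnitValues.lean` (box `u × (Du + 2)`) / `RealQuadraticClassNumberOneRepresented.lean`
(box `≈ 2√t × 2√(t/D)`), whose boxes are hopeless for units of size `e²⁹` or `e⁵⁷`.

Here the unit is certified THROUGH ITS DEFINITION: the continued fraction expansion of `δ` is run by a COMPUTABLE twin of
`QuadIrr.step` — for `Q > 0` the partial quotient is `⌊(P + √D)/Q⌋ = ⌊(P + ⌊√D⌋)/Q⌋`, an integer division once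
`s = ⌊√D⌋` is supplied (Jacobson–Williams, *Solving the Pell Equation*, §3.3, the remark after (3.11): `q_i = ⌊(P_i + d)/Q_i⌋`
with `d = ⌊√D⌋`) — and the numerator/denominator of Mathlib's convergents `Real.convergent` are computed by the same
recursion Mathlib defines them with (`Real.convergent_succ`). The cost is `O(p)` integer operations on numbers `< 2√D`
(plus the `p − 1` continuant steps), where `p` is the period length, independently of the size of `ε`.

* `QuadIrr.cpq s x = (P + s)/Q`, `QuadIrr.cstep s` (computable step), `QuadIrr.cconv s n x` (computable `(A_n, B_n)`),
  `QuadIrr.cycleCert D s p G B : Bool` — the certificate checker: `s² < D < (s+1)²` (so `s = ⌊√D⌋`, `D` non-square),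
  `D ≡ 0, 1 (mod 4)`, `0 < p`, `cstep^[p] x₁ = x₁` for `x₁ = cstep δ` and `cstep^[k] x₁ ≠ x₁` for `0 < k < p`,
  and `(G, B) = (2A_{p−1} − qB_{p−1}, B_{p−1})`;
* `QuadIrr.pq_eq_cpq`, `step_eq_cstep` (`Q > 0`), `iterate_step_eq_iterate_cstep` (along a reduced orbit),
  `convergent_num_den_eq_cconv` (pre-reduced start), `periodLength_eq_of_cstep`;
* **`QuadIrr.periodLength_eq_of_cycleCert`** and **`QuadIrr.fundUnit_eq_of_cycleCert :
  cycleCert D s p G B = true → fundUnit D = (G + B√D)/2`**;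
* VALUES (`decide +kernel` on the certificate; each also records `G² − DB² = ±4` by `norm_num`):
  **`fundUnit_225077 = (6739660009445796881424161 + 14206020256690055107145·√225077)/2`** (period `53`, norm `−4`,
  `log ε = 57.17005…`; `225077` is prime, the least-`L(1, χ_D)` fundamental discriminant in `200 < D ≤ 3·10⁵`),
  **`fundUnit_214037 = (3753351696386 + 8112875904·√214037)/2`** (period `32`, norm `+4`; `214037 = 193·1109` is the
  least positive fundamental discriminant with `χ_D(p) = −1` for all `p ≤ 47` (Lehmer–Lehmer–Shanks), and for all
  `p ≤ 59`), `fundUnit_24653 = (157 + √24653)/2` (period `1`), `fundUnit_74093 = (1361 + 5√74093)/2` (period `5`),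
  `fundUnit_170957 = (22729657 + 54973√170957)/2` (period `11`) — the deeper positive rungs of that ladder — and the
  regression `fundUnit 9173` (period `13`; the value of `RealQuadraticClassNumberOneRepresented.fundUnit_9173`);
* field side: `Quadratic.regulator_of_discr_eq_225077 / _214037 / _24653 / _74093 / _170957` (`R_K = log ε_D`).

First consumer: the landau-siegel rescue bed (`Zhang2022/RepairBedClassNumberFormulaReal.lean`: `L(1, χ_D) = 2 h_K log ε_D/√D`
at the positive moduli of its ladder and champion lists). Not here: class numbers (`h(225077) = 1` is the sequel
`RealQuadraticClassNumberOne225077.lean`; `h = 2, 4, 5, 3` at `214037, 24653, 74093, 170957` are not in the tree).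

## References

* [JacobsonWilliams2008] M. J. Jacobson, Jr., H. C. Williams, *Solving the Pell Equation*, CMS Books in Mathematics,
  Springer (2009), §3.1 (3.6)–(3.11), §3.3 (pp. 58–59; `q_i = ⌊(P_i + ⌊√D⌋)/Q_i⌋`), §5.3 (5.32)–(5.34).
* [LehmerLehmerShanks1970] D. H. Lehmer, E. Lehmer, D. Shanks, *Integer sequences having prescribed quadratic character*,
  Math. Comp. 24 (1970) 433–451, §1 (the least `D` with prescribed characters).
* [Cohen1993] H. Cohen, *A Course in Computational Algebraic Number Theory*, GTM 138, §5.7 (regulator by the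
  continued fraction of `ω`; Algorithm 5.7.1).
-/

noncomputable section

open Module NumberField NumberField.Units

namespace Literature.NumberTheory.QuadraticFields

namespace QuadIrr

variable {D : ℕ}

/-! ### Computable twins of the expansion -/

/-- The partial quotient with a supplied integer part of `√D`: `cpq s x = ⌊(P + s)/Q⌋` (integer division; equals
`⌊(P + √D)/Q⌋` when `s = ⌊√D⌋` and `Q > 0`). [cite: JacobsonWilliams2008, §3.3 (q_i = ⌊(P_i + ⌊√D⌋)/Q_i⌋, after (3.11))] -/
def cpq (s : ℕ) (x : QuadIrr D) : ℤ := (x.P + s) / x.Q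

/-- The computable continued fraction step `(P, Q) ↦ (qQ − P, (D − (qQ − P)²)/Q)` with `q = cpq s`.
[cite: JacobsonWilliams2008, §3.1 (3.11)] -/
def cstep (s : ℕ) (x : QuadIrr D) : QuadIrr D :=
  ⟨cpq s x * x.Q - x.P, ((D : ℤ) - (cpq s x * x.Q - x.P) ^ 2) / x.Q⟩

/-- The numerator and denominator `(A_n, B_n)` of the `n`-th convergent of `(P + √D)/Q`, computed by the recursion with
which Mathlib defines `Real.convergent` (`[q₀; φ₁] ↦ (q₀ A′ + B′, A′)` for the convergent `A′/B′` of `φ₁`).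
[cite: JacobsonWilliams2008, §3.1 (3.3)–(3.6)] -/
def cconv (s : ℕ) : ℕ → QuadIrr D → ℤ × ℤ
  | 0, x => (cpq s x, 1)
  | n + 1, x => (cpq s x * (cconv s n (cstep s x)).1 + (cconv s n (cstep s x)).2, (cconv s n (cstep s x)).1)

/-- **The principal-cycle certificate checker.** `cycleCert D s p G B` checks: `s² < D < (s+1)²` (so `D` is not a square and
`s = ⌊√D⌋`), `D ≡ 0, 1 (mod 4)`, `0 < p`, the computable expansion of `δ = (D mod 2 + √D)/2` returns to `x₁ = cstep δ`
after exactly `p` steps and not before, and `(G, B) = (2A − (D mod 2)B, B)` for the `(p−1)`-st convergent `A/B` of `δ`.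
[cite: JacobsonWilliams2008, §3.3 (pp. 58–59: ε = (G_{p−1} + B_{p−1}√D)/s) with §5.3 (5.33)] -/
def cycleCert (D s p : ℕ) (G B : ℤ) : Bool :=
  decide (s * s < D) && decide (D < (s + 1) * (s + 1)) && decide (D % 4 = 0 ∨ D % 4 = 1) && decide (0 < p) &&
    ((cstep s)^[p] (cstep s (principalStart D)) == cstep s (principalStart D)) &&
    (List.range p).all (fun k => k == 0 || (cstep s)^[k] (cstep s (principalStart D)) != cstep s (principalStart D)) &&
    (G == 2 * (cconv s (p - 1) (principalStart D)).1 - (D % 2 : ℕ) * (cconv s (p - 1) (principalStart D)).2) &&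
    (B == (cconv s (p - 1) (principalStart D)).2)

/-! ### The computable twins agree with the expansion -/

/-- For `Q > 0`, `⌊(P + √D)/Q⌋ = ⌊(P + ⌊√D⌋)/Q⌋`. [cite: JacobsonWilliams2008, §3.3 (remark after (3.11))] -/
theorem pq_eq_cpq {s : ℕ} (hs : s = Nat.sqrt D) {x : QuadIrr D} (hQ : 0 < x.Q) : x.pq = cpq s x := by
  unfold pq val cpq
  rw [Int.floor_div_cast_of_nonneg hQ.le, Int.floor_intCast_add, Real.floor_real_sqrt_eq_nat_sqrt, hs]

/-- For `Q > 0` the step is the computable step. [cite: JacobsonWilliams2008, §3.1 (3.11)] -/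
theorem step_eq_cstep {s : ℕ} (hs : s = Nat.sqrt D) {x : QuadIrr D} (hQ : 0 < x.Q) : step x = cstep s x := by
  unfold step cstep
  rw [pq_eq_cpq hs hQ]

/-- Along the orbit of a reduced quotient (all `Q_k > 0`) the expansion is the computable expansion.
[cite: JacobsonWilliams2008, §3.3 Thm. 3.8] -/
theorem iterate_step_eq_iterate_cstep (hD : ¬ IsSquare D) {s : ℕ} (hs : s = Nat.sqrt D) {x : QuadIrr D}
    (hx : x.IsReduced) (n : ℕ) : step^[n] x = (cstep s)^[n] x := by
  induction n with
  | zero => rfl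
  | succ n ih =>
    rw [Function.iterate_succ_apply', Function.iterate_succ_apply', ← ih]
    exact step_eq_cstep hs (isReduced_iterate hD hx n).1

/-- **The convergents of a pre-reduced `φ₀ = (P + √D)/Q` in lowest terms are `cconv`**: `A_n = (cconv s n x).1`,
`B_n = (cconv s n x).2`. [cite: JacobsonWilliams2008, §3.1 (3.3)–(3.6)] -/
theorem convergent_num_den_eq_cconv (hD : ¬ IsSquare D) {s : ℕ} (hs : s = Nat.sqrt D) {x : QuadIrr D}
    (hx : x.IsPreReduced) (n : ℕ) :
    (x.val.convergent n).num = (cconv s n x).1 ∧ ((x.val.convergent n).den : ℤ) = (cconv s n x).2 := by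
  induction n generalizing x with
  | zero =>
    rw [Real.convergent_zero, Rat.num_intCast, Rat.den_intCast]
    exact ⟨pq_eq_cpq hs hx.1, by simp [cconv]⟩
  | succ n ih =>
    have hadm := hx.isAdmissible
    have hx' : (step x).IsPreReduced := (hx.isReduced_step hD).isPreReduced
    obtain ⟨ih1, ih2⟩ := ih hx'
    rw [Real.convergent_succ, inv_fract_val hD hadm]
    set r := (step x).val.convergent n with hr
    have hrpos : 0 < r := lt_of_lt_of_le one_pos
      (one_le_convergent (irrational_val hD hx'.isAdmissible.1) hx'.2.2.1 n)
    obtain ⟨hnum, hden⟩ := num_den_intCast_add_inv ⌊x.val⌋ hrpos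
    have hpq : ⌊x.val⌋ = cpq s x := pq_eq_cpq hs hx.1
    have hst : step x = cstep s x := step_eq_cstep hs hx.1
    rw [hst] at ih1 ih2
    refine ⟨?_, ?_⟩
    · rw [hnum, hpq, ih1, ih2]; rfl
    · rw [hden, ih1]; rfl

/-- **The period length from the computable expansion**: if `cstep^[p] x₁ = x₁` for `x₁ = cstep δ` with `p > 0` and no
earlier return, then `periodLength D = p`. [cite: JacobsonWilliams2008, §3.3 (period length p of δ)] -/
theorem periodLength_eq_of_cstep (hD : ¬ IsSquare D) (hD4 : D % 4 = 0 ∨ D % 4 = 1) {s : ℕ} (hs : s = Nat.sqrt D)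
    {p : ℕ} (hp : 0 < p) (hcyc : (cstep s)^[p] (cstep s (principalStart D)) = cstep s (principalStart D))
    (hmin : ∀ k, 0 < k → k < p → (cstep s)^[k] (cstep s (principalStart D)) ≠ cstep s (principalStart D)) :
    periodLength D = p := by
  have hred := isReduced_principalFirst hD hD4
  have h1 : principalFirst D = cstep s (principalStart D) :=
    step_eq_cstep hs (by simp [principalStart])
  have hiter : ∀ n, step^[n] (principalFirst D) = (cstep s)^[n] (cstep s (principalStart D)) := fun n => by
    rw [iterate_step_eq_iterate_cstep hD hs hred n, h1]
  have hper : Function.IsPeriodicPt step p (principalFirst D) := by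
    change step^[p] (principalFirst D) = principalFirst D
    rw [hiter, hcyc, h1]
  have hle : periodLength D ≤ p := hper.minimalPeriod_le hp
  have hpos := periodLength_pos hD hD4
  by_contra hne
  have hlt : periodLength D < p := lt_of_le_of_ne hle hne
  have hfix : step^[periodLength D] (principalFirst D) = principalFirst D := iterate_periodLength_principalFirst
  rw [hiter, h1] at hfix
  exact hmin _ hpos hlt hfix

/-- What the certificate checker certifies, unpacked. [cite: JacobsonWilliams2008, §3.3 (pp. 58–59)] -/
theorem cycleCert_spec {D s p : ℕ} {G B : ℤ} (h : cycleCert D s p G B = true) :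
    s * s < D ∧ D < (s + 1) * (s + 1) ∧ (D % 4 = 0 ∨ D % 4 = 1) ∧ 0 < p ∧
      (cstep s)^[p] (cstep s (principalStart D)) = cstep s (principalStart D) ∧
      (∀ k, 0 < k → k < p → (cstep s)^[k] (cstep s (principalStart D)) ≠ cstep s (principalStart D)) ∧
      G = 2 * (cconv s (p - 1) (principalStart D)).1 - (D % 2 : ℕ) * (cconv s (p - 1) (principalStart D)).2 ∧
      B = (cconv s (p - 1) (principalStart D)).2 := by
  simp only [cycleCert, Bool.and_eq_true, decide_eq_true_eq, beq_iff_eq, List.all_eq_true, List.mem_range,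
    Bool.or_eq_true, bne_iff_ne, ne_eq] at h
  obtain ⟨⟨⟨⟨⟨⟨⟨hs1, hs2⟩, hD4⟩, hp⟩, hcyc⟩, hmin⟩, hG⟩, hB⟩ := h
  refine ⟨hs1, hs2, hD4, hp, hcyc, fun k hk hkp => ?_, hG, hB⟩
  have := hmin k hkp
  rcases this with h0 | hne
  · omega
  · exact hne

/-- **The period length by certificate**: `cycleCert D s p G B = true → periodLength D = p`.
[cite: JacobsonWilliams2008, §3.3 (period length p of δ)] -/
theorem periodLength_eq_of_cycleCert {D s p : ℕ} {G B : ℤ} (h : cycleCert D s p G B = true) :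
    periodLength D = p := by
  obtain ⟨hs1, hs2, hD4, hp, hcyc, hmin, -, -⟩ := cycleCert_spec h
  have hs : s = Nat.sqrt D := Nat.eq_sqrt.mpr ⟨hs1.le, hs2⟩
  have hD : ¬ IsSquare D := fun ⟨r, hr⟩ => Nat.not_exists_sq hs1 hs2 ⟨r, hr.symm⟩
  exact periodLength_eq_of_cstep hD hD4 hs hp hcyc hmin

/-- **The fundamental unit by certificate**: `cycleCert D s p G B = true → ε_D = fundUnit D = (G + B√D)/2`. Indeed
`ε = ∏_{k=1}^{p} ψ_k = A_{p−1} − B_{p−1} δ̄` (`num_sub_den_mul_conj`) with `δ̄ = (q − √D)/2`, and the certificate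
supplies `p` (`periodLength_eq_of_cycleCert`) and `(A_{p−1}, B_{p−1})` (`convergent_num_den_eq_cconv`).
[cite: JacobsonWilliams2008, §3.3 (pp. 58–59: ε = (G_{p−1} + √D B_{p−1})/s) with §5.3 (5.33)] -/
theorem fundUnit_eq_of_cycleCert {D s p : ℕ} {G B : ℤ} (h : cycleCert D s p G B = true) :
    fundUnit D = (G + B * Real.sqrt D) / 2 := by
  obtain ⟨hs1, hs2, hD4, hp, -, -, hG, hB⟩ := cycleCert_spec h
  have hs : s = Nat.sqrt D := Nat.eq_sqrt.mpr ⟨hs1.le, hs2⟩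
  have hD : ¬ IsSquare D := fun ⟨r, hr⟩ => Nat.not_exists_sq hs1 hs2 ⟨r, hr.symm⟩
  have hpl : periodLength D = p := periodLength_eq_of_cycleCert h
  have h0 := isPreReduced_principalStart hD hD4
  obtain ⟨m, hm⟩ : ∃ m, p = m + 1 := ⟨p - 1, by omega⟩
  have hm1 : p - 1 = m := by omega
  rw [hm1] at hG hB
  obtain ⟨hA, hB'⟩ := convergent_num_den_eq_cconv hD hs h0 m
  have key := num_sub_den_mul_conj hD h0 m
  have hconj : (principalStart D).conj = (((D % 2 : ℕ) : ℤ) - Real.sqrt D) / 2 := by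
    unfold conj principalStart; push_cast; rfl
  rw [fundUnit, hpl, hm, ← key, hconj, hG, hB, ← hA, ← hB']
  push_cast
  ring

/-! ### Values -/

/-- Regression: the certificate reproduces `ε₉₁₇₃ = (260989 + 2725√9173)/2` (period `13`), the value of
`RealQuadraticClassNumberOneRepresented.fundUnit_9173`. [cite: JacobsonWilliams2008, §5.3 (5.33)] -/
theorem fundUnit_9173' : fundUnit 9173 = (260989 + 2725 * Real.sqrt 9173) / 2 ∧ periodLength 9173 = 13 := by
  have h : cycleCert 9173 95 13 260989 2725 = true := by decide +kernel
  exact ⟨by exact_mod_cast fundUnit_eq_of_cycleCert h, periodLength_eq_of_cycleCert h⟩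

/-- **`ε₂₂₅₀₇₇ = fundUnit 225077 = (6739660009445796881424161 + 14206020256690055107145·√225077)/2`** (`225077` prime,
`≡ 5 (mod 8)`; principal cycle of period `53`; `log ε = 57.17005…`). [cite: JacobsonWilliams2008, §5.3 (5.33)] -/
theorem fundUnit_225077 :
    fundUnit 225077 = (6739660009445796881424161 + 14206020256690055107145 * Real.sqrt 225077) / 2 := by
  have h : cycleCert 225077 474 53 6739660009445796881424161 14206020256690055107145 = true := by decide +kernel
  exact_mod_cast fundUnit_eq_of_cycleCert h

/-- The period length of the principal cycle of `D = 225077` is `53`. [cite: JacobsonWilliams2008, §3.3 (period length p)] -/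
theorem periodLength_225077 : periodLength 225077 = 53 :=
  periodLength_eq_of_cycleCert (s := 474) (G := 6739660009445796881424161) (B := 14206020256690055107145)
    (by decide +kernel)

/-- The norm of `ε₂₂₅₀₇₇` is `−1`: `6739660009445796881424161² − 225077·14206020256690055107145² = −4` (the norm
identity `G² − DB² = 4(−1)^p`, period `p = 53` odd). [cite: JacobsonWilliams2008, §3.1 (3.18) with §5.3 (5.33)] -/
theorem fundUnit_225077_norm :
    (6739660009445796881424161 : ℤ) ^ 2 - 225077 * 14206020256690055107145 ^ 2 = -4 := by norm_num

/-- **`ε₂₁₄₀₃₇ = fundUnit 214037 = (3753351696386 + 8112875904·√214037)/2`** (`214037 = 193·1109`, the rung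
`D_47^+ = … = D_59^+` of the least-all-inert ladder; period `32`; `log ε = 28.95367…`). [cite: JacobsonWilliams2008, §5.3 (5.33)] -/
theorem fundUnit_214037 : fundUnit 214037 = (3753351696386 + 8112875904 * Real.sqrt 214037) / 2 := by
  have h : cycleCert 214037 462 32 3753351696386 8112875904 = true := by decide +kernel
  exact_mod_cast fundUnit_eq_of_cycleCert h

/-- The period length of the principal cycle of `D = 214037` is `32`. [cite: JacobsonWilliams2008, §3.3 (period length p)] -/
theorem periodLength_214037 : periodLength 214037 = 32 :=
  periodLength_eq_of_cycleCert (s := 462) (G := 3753351696386) (B := 8112875904) (by decide +kernel)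

/-- The norm of `ε₂₁₄₀₃₇` is `+1`: `3753351696386² − 214037·8112875904² = 4` (period `p = 32` even).
[cite: JacobsonWilliams2008, §3.1 (3.18) with §5.3 (5.33)] -/
theorem fundUnit_214037_norm : (3753351696386 : ℤ) ^ 2 - 214037 * 8112875904 ^ 2 = 4 := by norm_num

/-- `ε₂₄₆₅₃ = fundUnit 24653 = (157 + √24653)/2` (`24653 = 89·277 = 157² + 4`, the rung `D_29^+`; period `1`,
norm `−1`). [cite: JacobsonWilliams2008, §5.3 (5.33)] -/
theorem fundUnit_24653 : fundUnit 24653 = (157 + 1 * Real.sqrt 24653) / 2 := by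
  have h : cycleCert 24653 157 1 157 1 = true := by decide +kernel
  exact_mod_cast fundUnit_eq_of_cycleCert h

/-- `ε₇₄₀₉₃ = fundUnit 74093 = (1361 + 5√74093)/2` (`74093` prime, the rung `D_31^+ = D_37^+ = D_41^+`; period `5`,
norm `−1`: `1361² − 74093·25 = −4`). [cite: JacobsonWilliams2008, §5.3 (5.33)] -/
theorem fundUnit_74093 : fundUnit 74093 = (1361 + 5 * Real.sqrt 74093) / 2 := by
  have h : cycleCert 74093 272 5 1361 5 = true := by decide +kernel
  exact_mod_cast fundUnit_eq_of_cycleCert h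

/-- `ε₁₇₀₉₅₇ = fundUnit 170957 = (22729657 + 54973√170957)/2` (`170957` prime, the rung `D_43^+`; period `11`, norm `−1`).
[cite: JacobsonWilliams2008, §5.3 (5.33)] -/
theorem fundUnit_170957 : fundUnit 170957 = (22729657 + 54973 * Real.sqrt 170957) / 2 := by
  have h : cycleCert 170957 413 11 22729657 54973 = true := by decide +kernel
  exact_mod_cast fundUnit_eq_of_cycleCert h

/-- The norms at the three rungs: `157² − 24653 = −4`, `1361² − 74093·5² = −4`, `22729657² − 170957·54973² = −4`
(odd periods `1, 5, 11`). [cite: JacobsonWilliams2008, §3.1 (3.18) with §5.3 (5.33)] -/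
theorem fundUnit_rungs_norm : (157 : ℤ) ^ 2 - 24653 * 1 ^ 2 = -4 ∧ (1361 : ℤ) ^ 2 - 74093 * 5 ^ 2 = -4 ∧
    (22729657 : ℤ) ^ 2 - 170957 * 54973 ^ 2 = -4 := by norm_num

end QuadIrr

/-! ### Field side: the regulators -/

namespace Quadratic

variable {K : Type*} [Field K] [NumberField K]

/-- `d_K = 225077`: `R_K = log ((6739660009445796881424161 + 14206020256690055107145√225077)/2)` (`= 57.17005…`).
[cite: JacobsonWilliams2008, §5.3 (5.33)–(5.34)] -/
theorem regulator_of_discr_eq_225077 (h2 : finrank ℚ K = 2) (hd : NumberField.discr K = 225077) :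
    Units.regulator K =
      Real.log ((6739660009445796881424161 + 14206020256690055107145 * Real.sqrt 225077) / 2) :=
  regulator_eq_log_of_discr_eq h2 (D := 225077) (by exact_mod_cast hd) QuadIrr.fundUnit_225077

/-- `d_K = 214037`: `R_K = log ((3753351696386 + 8112875904√214037)/2)` (`= 28.95367…`). [cite: JacobsonWilliams2008, §5.3 (5.33)–(5.34)] -/
theorem regulator_of_discr_eq_214037 (h2 : finrank ℚ K = 2) (hd : NumberField.discr K = 214037) :
    Units.regulator K = Real.log ((3753351696386 + 8112875904 * Real.sqrt 214037) / 2) :=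
  regulator_eq_log_of_discr_eq h2 (D := 214037) (by exact_mod_cast hd) QuadIrr.fundUnit_214037

/-- `d_K = 24653`: `R_K = log ((157 + √24653)/2)` (`= 5.05628…`). [cite: JacobsonWilliams2008, §5.3 (5.33)–(5.34)] -/
theorem regulator_of_discr_eq_24653 (h2 : finrank ℚ K = 2) (hd : NumberField.discr K = 24653) :
    Units.regulator K = Real.log ((157 + 1 * Real.sqrt 24653) / 2) :=
  regulator_eq_log_of_discr_eq h2 (D := 24653) (by exact_mod_cast hd) QuadIrr.fundUnit_24653

/-- `d_K = 74093`: `R_K = log ((1361 + 5√74093)/2)` (`= 7.21597…`). [cite: JacobsonWilliams2008, §5.3 (5.33)–(5.34)] -/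
theorem regulator_of_discr_eq_74093 (h2 : finrank ℚ K = 2) (hd : NumberField.discr K = 74093) :
    Units.regulator K = Real.log ((1361 + 5 * Real.sqrt 74093) / 2) :=
  regulator_eq_log_of_discr_eq h2 (D := 74093) (by exact_mod_cast hd) QuadIrr.fundUnit_74093

/-- `d_K = 170957`: `R_K = log ((22729657 + 54973√170957)/2)` (`= 16.93918…`). [cite: JacobsonWilliams2008, §5.3 (5.33)–(5.34)] -/
theorem regulator_of_discr_eq_170957 (h2 : finrank ℚ K = 2) (hd : NumberField.discr K = 170957) :
    Units.regulator K = Real.log ((22729657 + 54973 * Real.sqrt 170957) / 2) :=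
  regulator_eq_log_of_discr_eq h2 (D := 170957) (by exact_mod_cast hd) QuadIrr.fundUnit_170957

end Quadratic

end Literature.NumberTheory.QuadraticFields

end
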